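import Summits.KontsevichZagierPeriods.KontsevichZagierPeriods.Theorems.RootDecompZetaThreeFrontierWordRungTwoP4

/-! # `RootDecompZetaThreeFrontierWordRungTwoP5` — part 5/12 of the mechanical ≤270-line split of `RungTwo.stripped.lean`
(split by the decomp-kz census seat for landing; mathematics unchanged; part 5 continues part 4). -/

noncomputable section

namespace Summit.KontsevichZagierPeriods.RootDecompZetaThreeFrontier.WordLayer
open Set MeasureTheory MvPolynomial
open Literature.NumberTheory.Transcendental
open Summit.KontsevichZagierPeriods.KontsevichZagierPeriods.Theses.RootDecompZetaThreeFrontier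
  (HigherWeightDescent)
open Summit.KontsevichZagierPeriods.KontsevichZagierPeriods.Theses.LinRedNormalForm
  (DihedralNormalForm MzvKernelInKZ HoffmanSpanInKZ HoffmanIndependence)

section RungTwoEngines
open Literature.ModelTheory.ExponentialFields (IsSemialgebraic)













/-! (private copy of `snoc_one_zero` — its public twin in this chain was privatised under the dedup.landed policy) -/
/-- Auxiliary step `snoc_one_zero`. [bookkeeping] -/
private theorem snoc_one_zero (x : Fin 1 → ℝ) (t : ℝ) : (Fin.snoc x t : Fin 2 → ℝ) 0 = x 0 := rfl

/-! (private copy of `snoc_one_one` — its public twin in this chain was privatised under the dedup.landed policy) -/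
/-- Auxiliary step `snoc_one_one`. [bookkeeping] -/
private theorem snoc_one_one (x : Fin 1 → ℝ) (t : ℝ) : (Fin.snoc x t : Fin 2 → ℝ) 1 = t := rfl

/-! (private copy of `strictAnti_fin_one` — dedup.landed / split policy; origin part RootDecompZetaThreeFrontierWordRungTwoP1) -/
/-- Auxiliary step `strictAnti_fin_one`. [bookkeeping] -/
private theorem strictAnti_fin_one (y : Fin 1 → ℝ) : StrictAnti y := fun a b hab =>
  absurd hab (by rw [Subsingleton.elim a b]; exact lt_irrefl _)

/-! (private copy of `mem_simplex_one_iff` — dedup.landed / split policy; origin part RootDecompZetaThreeFrontierWordRungTwoP1) -/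
/-- Membership in `simplex_one_iff`, unfolded. [bookkeeping] -/
private theorem mem_simplex_one_iff (y : Fin 1 → ℝ) : y ∈ KZ.openOrderedSimplex 1 ↔ 0 < y 0 ∧ y 0 < 1 := by
  constructor
  · rintro ⟨h0, h1, -⟩
    exact ⟨h0 0, h1 0⟩
  · rintro ⟨h0, h1⟩
    refine ⟨fun i => ?_, fun i => ?_, strictAnti_fin_one y⟩
    · rw [Fin.fin_one_eq_zero i]; exact h0
    · rw [Fin.fin_one_eq_zero i]; exact h1

/-! (private copy of `mem_simplex_two_iff` — dedup.landed / split policy; origin part RootDecompZetaThreeFrontierWordRungTwoP1) -/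
/-- Membership in `simplex_two_iff`, unfolded. [bookkeeping] -/
private theorem mem_simplex_two_iff (z : Fin 2 → ℝ) :
    z ∈ KZ.openOrderedSimplex 2 ↔ 0 < z 1 ∧ z 1 < z 0 ∧ z 0 < 1 := by
  constructor
  · rintro ⟨h0, h1, ha⟩
    exact ⟨h0 1, ha (show (0 : Fin 2) < 1 by decide), h1 0⟩
  · rintro ⟨h1, h10, h0⟩
    refine ⟨Fin.forall_fin_two.mpr ⟨h1.trans h10, h1⟩, Fin.forall_fin_two.mpr ⟨h0, h10.trans h0⟩,
      Fin.strictAnti_iff_succ_lt.mpr (Fin.forall_fin_one.mpr ?_)⟩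
    simpa using h10

/-- **(E2) duality on `Δ₂` for any integrand.**  The involution `σ(t₀,t₁) = (1-t₁, 1-t₀)` maps `Δ₂` onto itself with `|det| = 1`;
if `r`, `r'` are representations on `Δ₂` with `r.integrand = r'.integrand ∘ σ` on `Δ₂`, then `[r] ≡ [r']`.
[Kontsevich–Zagier 2001 §1.2 rule (2)] -/
theorem dualityTwo (r r' : KZ.IntegralRep 2) (hd : r.domain = KZ.openOrderedSimplex 2)
    (hd' : r'.domain = KZ.openOrderedSimplex 2)
    (hi : ∀ z ∈ KZ.openOrderedSimplex 2, r.integrand z = r'.integrand (spΦ z)) :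
    KZ.of r - KZ.of r' ∈ KZ.relations := by
  have hΔ := KZ.isSemialgebraic_openOrderedSimplex 2
  have hΦsa : IsSemialgebraicMapOn ℚ r.domain spΦ := by
    rw [hd]
    exact (isSemialgebraicMapOn_aeval hΔ ![MvPolynomial.C 1 - MvPolynomial.X 1,
      MvPolynomial.C 1 - MvPolynomial.X 0]).congr fun z _ => by
        funext j
        fin_cases j <;> simp [spΦ_zero, spΦ_one]
  have hder : ∀ x ∈ r.domain, HasFDerivWithinAt spΦ spL r.domain x := by
    intro x _
    have h : HasFDerivAt (fun z : Fin 2 → ℝ => (fun _ => (1 : ℝ)) + spL z) spL x :=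
      (spL.hasFDerivAt).const_add _
    have e : spΦ = fun z : Fin 2 → ℝ => (fun _ => (1 : ℝ)) + spL z := funext spΦ_eq
    rw [e]
    exact h.hasFDerivWithinAt
  have hinj : InjOn spΦ r.domain := fun a _ b _ h => by
    have := congrArg spΦ h
    rwa [spΦ_spΦ, spΦ_spΦ] at this
  have hdom : r'.domain = spΦ '' r.domain := by rw [hd, hd', image_spΦ]
  refine KZ.changeOfVariablesRel_subset_relations ⟨2, r, r', spΦ, fun _ => spL, hΦsa, hder, hinj, hdom,
    fun z hz => ?_, rfl⟩
  have hz' : z ∈ KZ.openOrderedSimplex 2 := by rw [← hd]; exact hz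
  show r.integrand z = r'.integrand (spΦ z) * |spL.det|
  rw [abs_det_spL, mul_one, hi z hz']

end RungTwoEngines
/-! ## §16  CORNER CLASSES (gen 9 addendum 2): the rung-2 algorithm's classes `q·C(j,k;β,γ) = q·t₁^j(1-t₀)^k/(t₀^β(1-t₁)^γ)` IN THE KERNEL —
every class with `β ≤ j+1`, `γ ≤ k+1` is dominated by `ω₀ω₁`, hence integrable (S2); the classes WITHOUT a `(1,1)`-pole (`γ = 0`) are
RATIONAL by one (E1) move + rung 1, those without a `(0,0)`-pole (`β = 0`) by (E2) + the previous case, and the SIMPLE-POLE classes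
`q·C(j,k;1,1)` lie in `ℚ·[Δ₂, ω₀ω₁] + ℚ·[pt]` by a double induction of rule-1b splits (S4's base); consequently (§16c) the whole SIMPLE-POLE LAYER
of rung 2 — every `[Δ₂, P(t₀,t₁)/(t₀(1-t₁))]`, `P ∈ ℚ[t₀,t₁]` arbitrary — is decided: it lies in the weight-`≤ 2` word span modulo `KZ.relations`. -/

section CornerClasses
open Literature.ModelTheory.ExponentialFields (IsSemialgebraic)
/-- the corner class `C(j,k;β,γ)(t₀,t₁) = t₁^j (1-t₀)^k / (t₀^β (1-t₁)^γ)` of the rung-2 algorithm (NODE.md §(E), S2) -/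
def cc (j k β γ : ℕ) (z : Fin 2 → ℝ) : ℝ := z 1 ^ j * (1 - z 0) ^ k / (z 0 ^ β * (1 - z 1) ^ γ)

/-- the classes (with a rational coefficient) are semialgebraic on `Δ₂` … -/
theorem cc_sa (q : ℚ) (j k β γ : ℕ) : IsSemialgebraicFunOn ℚ (KZ.openOrderedSimplex 2) (fun z => (q : ℝ) * cc j k β γ z) := by
  refine (isSemialgebraicFunOn_aeval_div_aeval (KZ.isSemialgebraic_openOrderedSimplex 2)
    (MvPolynomial.C q * (MvPolynomial.X 1 ^ j * (MvPolynomial.C 1 - MvPolynomial.X 0) ^ k))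
    (MvPolynomial.X 0 ^ β * (MvPolynomial.C 1 - MvPolynomial.X 1) ^ γ) fun z hz => ?_).congr fun z hz => ?_
  · obtain ⟨h1, h10, h0⟩ := (mem_simplex_two_iff z).1 hz
    have : (1 : ℝ) - z 1 ≠ 0 := by linarith
    have : z 0 ≠ 0 := (h1.trans h10).ne'
    simp only [map_mul, map_pow, map_sub, MvPolynomial.aeval_X, map_one]
    positivity
  · simp only [map_mul, map_pow, map_sub, MvPolynomial.aeval_X, MvPolynomial.aeval_C, eq_ratCast, map_one, cc,
      mul_div_assoc']

/-- … and on the closed band over `Δ₁` -/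
theorem cc_sa_band (q : ℚ) (j k β γ : ℕ) : IsSemialgebraicFunOn ℚ
    (KZlog.band (KZ.openOrderedSimplex 1) (fun _ : Fin 1 → ℝ => (0 : ℝ)) (fun y : Fin 1 → ℝ => y (Fin.last 0)))
    (fun z => (q : ℝ) * cc j k β γ z) := by
  refine (isSemialgebraicFunOn_aeval_div_aeval isSemialgebraic_bandTwo
    (MvPolynomial.C q * (MvPolynomial.X 1 ^ j * (MvPolynomial.C 1 - MvPolynomial.X 0) ^ k))
    (MvPolynomial.X 0 ^ β * (MvPolynomial.C 1 - MvPolynomial.X 1) ^ γ) fun z hz => ?_).congr fun z hz => ?_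
  · obtain ⟨⟨h0, h01⟩, h1, h10⟩ := (mem_bandTwo_iff z).1 hz
    have : (1 : ℝ) - z 1 ≠ 0 := by linarith
    have : z 0 ≠ 0 := h0.ne'
    simp only [map_mul, map_pow, map_sub, MvPolynomial.aeval_X, map_one]
    positivity
  · simp only [map_mul, map_pow, map_sub, MvPolynomial.aeval_X, MvPolynomial.aeval_C, eq_ratCast, map_one, cc,
      mul_div_assoc']

/-- Auxiliary step `cc_nonneg`. [bookkeeping] -/
theorem cc_nonneg (j k β γ : ℕ) {z : Fin 2 → ℝ} (hz : z ∈ KZ.openOrderedSimplex 2) : 0 ≤ cc j k β γ z := by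
  obtain ⟨h1, h10, h0⟩ := (mem_simplex_two_iff z).1 hz
  have : 0 < 1 - z 1 := by linarith
  have : 0 ≤ 1 - z 0 := by linarith
  have : 0 < z 0 := h1.trans h10
  unfold cc
  positivity

/-- **(S2) domination**: for `β ≤ j+1`, `γ ≤ k+1` the class is bounded by the word `ω₀ω₁ = 1/(t₀(1-t₁))` on `Δ₂` -/
theorem cc_le_spW {j k β γ : ℕ} (hj : β ≤ j + 1) (hk : γ ≤ k + 1) {z : Fin 2 → ℝ}
    (hz : z ∈ KZ.openOrderedSimplex 2) : cc j k β γ z ≤ spW z := by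
  obtain ⟨h1, h10, h0⟩ := (mem_simplex_two_iff z).1 hz
  have hz0 : 0 < z 0 := h1.trans h10
  have h1' : 0 < 1 - z 1 := by linarith
  have h0' : 0 ≤ 1 - z 0 := by linarith
  have hA : z 1 ^ j * z 0 ≤ z 0 ^ β :=
    calc z 1 ^ j * z 0 ≤ z 0 ^ j * z 0 := by gcongr
      _ = z 0 ^ (j + 1) := by ring
      _ ≤ z 0 ^ β := pow_le_pow_of_le_one hz0.le h0.le hj
  have hB : (1 - z 0) ^ k * (1 - z 1) ≤ (1 - z 1) ^ γ :=
    calc (1 - z 0) ^ k * (1 - z 1) ≤ (1 - z 1) ^ k * (1 - z 1) := by gcongr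
      _ = (1 - z 1) ^ (k + 1) := by ring
      _ ≤ (1 - z 1) ^ γ := pow_le_pow_of_le_one h1'.le (by linarith) hk
  unfold cc spW
  rw [div_le_div_iff₀ (by positivity) (by positivity), one_mul]
  calc z 1 ^ j * (1 - z 0) ^ k * (z 0 * (1 - z 1)) = (z 1 ^ j * z 0) * ((1 - z 0) ^ k * (1 - z 1)) := by ring
    _ ≤ z 0 ^ β * (1 - z 1) ^ γ := mul_le_mul hA hB (by positivity) (by positivity)

/-- **(S2) every class with `β ≤ j+1`, `γ ≤ k+1` is absolutely integrable on `Δ₂`** (dominated by `|q|·ω₀ω₁`) -/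
theorem cc_integrableOn (q : ℚ) {j k β γ : ℕ} (hj : β ≤ j + 1) (hk : γ ≤ k + 1) :
    IntegrableOn (fun z => (q : ℝ) * cc j k β γ z) (KZ.openOrderedSimplex 2) := by
  refine integrableOn_of_dominated (KZ.isSemialgebraic_openOrderedSimplex 2) (cc_sa q j k β γ)
    (spW_integrableOn.const_mul |(q : ℝ)|) fun z hz => ?_
  rw [abs_mul, abs_of_nonneg (cc_nonneg j k β γ hz)]
  exact mul_le_mul_of_nonneg_left (cc_le_spW hj hk hz) (abs_nonneg _)

/-- the class `q·C(j,k;β,γ)` as a representation on `Δ₂` -/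
def ccRep (q : ℚ) (j k β γ : ℕ) (hj : β ≤ j + 1) (hk : γ ≤ k + 1) : KZ.IntegralRep 2 :=
  repTwo (fun z => (q : ℝ) * cc j k β γ z) (cc_sa q j k β γ) (cc_integrableOn q hj hk)

/-! ### 16a  classes without a `(1,1)`-pole are rational: one (E1) move with a polynomial-in-`t₁` primitive, then rung 1;
classes without a `(0,0)`-pole by (E2) first -/

/-- the primitive `q·t₁^{j+1}(1-t₀)^k/((j+1)t₀^β)` of `q·C(j,k;β,0)` in `t₁` -/
def ccF (q : ℚ) (j k β : ℕ) (z : Fin 2 → ℝ) : ℝ :=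
  (q : ℝ) * (z 1 ^ (j + 1) * (1 - z 0) ^ k) / (((j : ℝ) + 1) * z 0 ^ β)

/-- Auxiliary step `ccF_sa_band`. [bookkeeping] -/
theorem ccF_sa_band (q : ℚ) (j k β : ℕ) : IsSemialgebraicFunOn ℚ
    (KZlog.band (KZ.openOrderedSimplex 1) (fun _ : Fin 1 → ℝ => (0 : ℝ)) (fun y : Fin 1 → ℝ => y (Fin.last 0)))
    (ccF q j k β) := by
  refine (isSemialgebraicFunOn_aeval_div_aeval isSemialgebraic_bandTwo
    (MvPolynomial.C q * (MvPolynomial.X 1 ^ (j + 1) * (MvPolynomial.C 1 - MvPolynomial.X 0) ^ k))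
    (((j : MvPolynomial (Fin 2) ℚ) + 1) * MvPolynomial.X 0 ^ β) fun z hz => ?_).congr fun z hz => ?_
  · obtain ⟨⟨h0, h01⟩, h1, h10⟩ := (mem_bandTwo_iff z).1 hz
    have : z 0 ≠ 0 := h0.ne'
    simp only [map_mul, map_pow, map_add, map_natCast, MvPolynomial.aeval_X, map_one]
    positivity
  · simp only [map_mul, map_pow, map_sub, map_add, map_natCast, MvPolynomial.aeval_X, MvPolynomial.aeval_C,
      eq_ratCast, map_one, ccF]

/-- Auxiliary step `ccF_snoc`. [bookkeeping] -/
theorem ccF_snoc (q : ℚ) (j k β : ℕ) (y : Fin 1 → ℝ) (t : ℝ) :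
    ccF q j k β (Fin.snoc y t) = t ^ (j + 1) * ((q : ℝ) * (1 - y 0) ^ k / (((j : ℝ) + 1) * y 0 ^ β)) := by
  simp only [ccF, snoc_one_zero, snoc_one_one]
  ring

/-- Auxiliary step `cc_zero_snoc`. [bookkeeping] -/
theorem cc_zero_snoc (q : ℚ) (j k β : ℕ) (y : Fin 1 → ℝ) (t : ℝ) :
    (q : ℝ) * cc j k β 0 (Fin.snoc y t) = t ^ j * ((q : ℝ) * (1 - y 0) ^ k / y 0 ^ β) := by
  simp only [cc, snoc_one_zero, snoc_one_one, pow_zero, mul_one]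
  ring

/-- **the classes `q·C(j,k;β,0)`, `β ≤ j+1`, are rational**: `[Δ₂, q·C(j,k;β,0)] ≡ [pt, ρ]` (an element of the weight-`0` word span). -/
theorem cc_gamma_zero (q : ℚ) (j k β : ℕ) (hj : β ≤ j + 1) (r : KZ.IntegralRep 2)
    (hd : r.domain = KZ.openOrderedSimplex 2) (hi : EqOn r.integrand (fun z => (q : ℝ) * cc j k β 0 z) r.domain) :
    ∃ m ∈ AddSubgroup.closure (wordGensLE 0), KZ.of r - m ∈ KZ.relations := by
  -- (E1): `∂₁ ccF = q·C(j,k;β,0)` on every fibre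
  have hcont : ∀ y ∈ KZ.openOrderedSimplex 1,
      ContinuousOn (fun t => ccF q j k β (Fin.snoc y t)) (Icc 0 (y (Fin.last 0))) := fun y _ => by
    have e : (fun t => ccF q j k β (Fin.snoc y t)) =
        fun t => t ^ (j + 1) * ((q : ℝ) * (1 - y 0) ^ k / (((j : ℝ) + 1) * y 0 ^ β)) := funext (ccF_snoc q j k β y)
    rw [e]
    exact ((continuous_pow (j + 1)).mul continuous_const).continuousOn
  have hder : ∀ y ∈ KZ.openOrderedSimplex 1, ∀ t ∈ Ioo 0 (y (Fin.last 0)),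
      HasDerivAt (fun s => ccF q j k β (Fin.snoc y s)) ((fun z => (q : ℝ) * cc j k β 0 z) (Fin.snoc y t)) t :=
    fun y hy t _ => by
    obtain ⟨hy0, hy1⟩ := (mem_simplex_one_iff y).1 hy
    have e : (fun s => ccF q j k β (Fin.snoc y s)) =
        fun s => s ^ (j + 1) * ((q : ℝ) * (1 - y 0) ^ k / (((j : ℝ) + 1) * y 0 ^ β)) := funext (ccF_snoc q j k β y)
    rw [e]
    show HasDerivAt _ ((q : ℝ) * cc j k β 0 (Fin.snoc y t)) t
    rw [cc_zero_snoc]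
    have h := (hasDerivAt_pow (j + 1) t).mul_const ((q : ℝ) * (1 - y 0) ^ k / (((j : ℝ) + 1) * y 0 ^ β))
    refine h.congr_deriv ?_
    rw [Nat.add_sub_cancel, Nat.cast_add, Nat.cast_one]
    have hj1 : (j : ℝ) + 1 ≠ 0 := by positivity
    have hy0' : y 0 ^ β ≠ 0 := pow_ne_zero _ hy0.ne'
    field_simp
  obtain ⟨r', hd', hi', hrel⟩ := nl_two (cc_sa_band q j k β 0) (ccF_sa_band q j k β) hcont hder r hd hi
  -- rung 1: the boundary integrand is the polynomial `q·y^{j+1-β}(1-y)^k/(j+1)`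
  obtain ⟨e, he⟩ := Nat.exists_eq_add_of_le hj
  have hi'' : EqOn r'.integrand (fun t => MvPolynomial.aeval t
      (MvPolynomial.C (q / ((j : ℚ) + 1)) * MvPolynomial.X 0 ^ e * (MvPolynomial.C 1 - MvPolynomial.X 0) ^ k) /
      ((∏ i, t i ^ (0 : Fin 1 → ℕ) i) * (∏ i, (1 - t i) ^ (0 : Fin 1 → ℕ) i) *
        ∏ i, ∏ i', if i < i' then (t i - t i') ^ (0 : Fin 1 → Fin 1 → ℕ) i i' else 1)) r'.domain := by
    intro t ht
    rw [hd'] at ht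
    obtain ⟨ht0, ht1⟩ := (mem_simplex_one_iff t).1 ht
    rw [hi']
    show ccF q j k β (Fin.snoc t (t (Fin.last 0))) - ccF q j k β (Fin.snoc t 0) = _
    rw [ccF_snoc, ccF_snoc, show (Fin.last 0 : Fin 1) = 0 from rfl]
    simp only [Pi.zero_apply, pow_zero, Finset.prod_const_one, mul_one, Fin.prod_univ_one,
      lt_self_iff_false, if_false, div_one, map_mul, map_pow, map_sub, MvPolynomial.aeval_C,
      MvPolynomial.aeval_X, eq_ratCast, map_one, ne_eq, Nat.add_one_ne_zero,
      not_false_eq_true, zero_pow, zero_mul, sub_zero]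
    rw [he, pow_add]
    have hj1 : (j : ℝ) + 1 ≠ 0 := by positivity
    have ht0' : t 0 ^ β ≠ 0 := pow_ne_zero _ ht0.ne'
    push_cast
    field_simp
  obtain ⟨m, hm, hrel'⟩ := gz_one r' _ 0 0 0 hd' hi''
  refine ⟨m, AddSubgroup.subset_closure hm, ?_⟩
  have := add_mem hrel hrel'
  rwa [sub_add_sub_cancel] at this

/-- **the classes `q·C(j,k;0,γ)`, `γ ≤ k+1`, are rational**: (E2) carries `C(j,k;0,γ)` to `C(k,j;γ,0)`. -/
theorem cc_beta_zero (q : ℚ) (j k γ : ℕ) (hk : γ ≤ k + 1) (r : KZ.IntegralRep 2)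
    (hd : r.domain = KZ.openOrderedSimplex 2) (hi : EqOn r.integrand (fun z => (q : ℝ) * cc j k 0 γ z) r.domain) :
    ∃ m ∈ AddSubgroup.closure (wordGensLE 0), KZ.of r - m ∈ KZ.relations := by
  have hdual : KZ.of r - KZ.of (ccRep q k j γ 0 hk (Nat.zero_le _)) ∈ KZ.relations :=
    dualityTwo r _ hd rfl fun z hz => by
      rw [hi (by rw [hd]; exact hz)]
      show (q : ℝ) * cc j k 0 γ z = (q : ℝ) * cc k j γ 0 (spΦ z)
      simp only [cc, spΦ_zero, spΦ_one, sub_sub_cancel, pow_zero, one_mul, mul_one]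
      ring
  obtain ⟨m, hm, hrel⟩ := cc_gamma_zero q k j γ hk (ccRep q k j γ 0 hk (Nat.zero_le _)) rfl fun z _ => rfl
  refine ⟨m, hm, ?_⟩
  have := add_mem hdual hrel
  rwa [sub_add_sub_cancel] at this

/-! ### 16b  the simple-pole classes `q·C(j,k;1,1)`: rule-1b induction down to `q·C(0,0;1,1) = q·ω₀ω₁` -/

/-- Auxiliary step `closure_zero_le_two`. [bookkeeping] -/
theorem closure_zero_le_two : AddSubgroup.closure (wordGensLE 0) ≤ AddSubgroup.closure (wordGensLE 2) :=
  AddSubgroup.closure_mono (wordGensLE_mono (Nat.zero_le 2))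

end CornerClasses
end Summit.KontsevichZagierPeriods.RootDecompZetaThreeFrontier.WordLayer
end
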